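import Mathlib
import HarnessLib
import Summits.NavierStokesRegularity.NavierStokesRegularity.Theorems.PoloidalWindowDoorLrcModEntireTwistingTHFlatLever

/-!
# Item `LrcModEntire` (stmt-NavierStokesRegularity-20428), registry twist_split v8 — THE FLAT LEVER, POINTWISE FORM: degenerate points cannot separate definite points
LEAD of item 20428 ns-poloidal-K2-p3 g15 (`--supports stmt-NavierStokesRegularity-20428 --as helper`).  Memo `Cruxes/LrcModEntire/T2B-g15.md` §17c.  The coefficient lemma of
`…TwistingTHFlatLever` needs only POINTWISE convergence of the normalised cross-section maxima `(R(s,z) − N)/zᵏ` (no uniform remainder), so the flat lever extends to arcs on which the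
transversal quartic form degenerates somewhere: at a definite point the limit is `−m(s)` (quartic tube, with the maximiser confined near the centre by «the centre is the only hot point
of its cross-section»), at a point where the form has a null direction inside the tube the limit is `0` (global maximum above, the null direction below).  Hence `m ≥ 0` is
quasiconcave on the whole arc and **an interior point with `m = 0` between two points with `m > 0` is impossible** (class-free; the binder-level instance follows as in `…FlatChain`).
* `quasiconvexOn_of_tendsto_pow` — pointwise-limit form of (F-ii);
* `tendsto_coeff_of_expansion` — a one-sided expansion `|R z − (N − m z⁴)| ≤ C z⁵` gives the limit `−m`;
* `tendsto_coeff_zero_of_nullDirection` / `tendsto_coeff_of_nullDirection` — `N − C z⁵ ≤ R z ≤ N` gives the limit `0`; supplied by a null direction `Q(η₀,1) = 0` and the global bound `g ≤ N`;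
* `tendsto_coeff_of_definite` — at a definite point (`λ(n⁴+z⁴) ≤ Q`) of a possibly THICK tube whose centre is the only hot point of its cross-section, the limit is `−m`;
* `no_interior_degeneracy` — `m` quasiconcave on `[a₁,a₂]`, `m(a₁) > 0`, `m(a₂) > 0` ⇒ `m > 0` on `[a₁,a₂]`.
WHAT THIS IS NOT: not a claim about Navier–Stokes regularity and not a proof of `stub_T2bFlat` (bears_on LADDER-NS N0, item 20428 / crux 19708; OPEN, ⟨27893⟩ OPEN).
-/

set_option linter.style.longLine false
-- the summit and its single sub-problem share the name (CONVENTIONS §1), as in every Theorems file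
set_option linter.dupNamespace false

namespace Summit.NavierStokesRegularity.NavierStokesRegularity.Theorems.PoloidalWindowDoorLrcModEntireTwistingTHFlatLeverPointwise

open Set Filter Topology
open Summit.NavierStokesRegularity.NavierStokesRegularity.Theorems.PoloidalWindowDoorLrcModEntireRidgeSecondOrder
open Summit.NavierStokesRegularity.NavierStokesRegularity.Theorems.PoloidalWindowDoorLrcModEntireTwistingTHFlatLever

/-- **(F-ii, pointwise form).**  If each `s ↦ R(s,z)` is quasiconvex on the convex set `S` for `0 < z ≤ δ′` and `(R(s,z) − N)/zᵏ → μ(s)` as `z → 0⁺` for every `s ∈ S`, then `μ` is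
quasiconvex on `S`. -/
theorem quasiconvexOn_of_tendsto_pow {S : Set ℝ} (hS : Convex ℝ S) {R : ℝ → ℝ → ℝ} {μ : ℝ → ℝ} {N δ' : ℝ} (hδ' : 0 < δ') (k : ℕ)
    (hlim : ∀ s ∈ S, Tendsto (fun z => (R s z - N) / z ^ k) (𝓝[>] 0) (𝓝 (μ s)))
    (hqc : ∀ z : ℝ, 0 < z → z ≤ δ' → QuasiconvexOn ℝ S fun s => R s z) :
    QuasiconvexOn ℝ S μ := by
  set F : ℝ → ℝ → ℝ := fun z s => (z ^ k)⁻¹ * R s z + -((z ^ k)⁻¹ * N) with hFdef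
  haveI : (𝓝[>] (0 : ℝ)).NeBot := nhdsGT_neBot 0
  have hev : ∀ᶠ z in 𝓝[>] (0 : ℝ), 0 < z ∧ z ≤ δ' := by
    have h1 : ∀ᶠ z in 𝓝[>] (0 : ℝ), 0 < z := self_mem_nhdsWithin
    have h2 : ∀ᶠ z in 𝓝[>] (0 : ℝ), z ≤ δ' := by
      have : ∀ᶠ z in 𝓝 (0 : ℝ), z ≤ δ' := by
        filter_upwards [Metric.closedBall_mem_nhds (0 : ℝ) hδ'] with z hz
        rw [Metric.mem_closedBall, Real.dist_eq, sub_zero] at hz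
        exact (le_abs_self z).trans hz
      exact nhdsWithin_le_nhds this
    filter_upwards [h1, h2] with z hz1 hz2
    exact ⟨hz1, hz2⟩
  refine quasiconvexOn_of_tendsto_eventually (l := 𝓝[>] (0 : ℝ)) hS (F := F) ?_ ?_
  · filter_upwards [hev] with z hz
    exact quasiconvexOn_affine_pos (hqc z hz.1 hz.2) (by have := pow_pos hz.1 k; positivity) _
  · intro s hs
    have e : (fun z => F z s) = fun z => (R s z - N) / z ^ k := by
      funext z; rw [hFdef]; simp only; rw [div_eq_inv_mul]; ring
    rw [e]; exact hlim s hs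

/-- A one-sided expansion `|R z − (N − m z⁴)| ≤ C z⁵` (`0 < z ≤ δ`) gives `(R z − N)/z⁴ → −m` as `z → 0⁺`. -/
theorem tendsto_coeff_of_expansion {R : ℝ → ℝ} {N m C δ : ℝ} (hδ : 0 < δ)
    (hexp : ∀ z : ℝ, 0 < z → z ≤ δ → |R z - (N - m * z ^ 4)| ≤ C * z ^ 5) :
    Tendsto (fun z => (R z - N) / z ^ 4) (𝓝[>] 0) (𝓝 (-m)) := by
  have hC : 0 ≤ C := by
    have h := hexp δ hδ le_rfl
    have h5 : 0 < δ ^ 5 := by positivity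
    nlinarith [abs_nonneg (R δ - (N - m * δ ^ 4))]
  rw [Metric.tendsto_nhdsWithin_nhds]
  intro ε hε
  refine ⟨min δ (ε / (C + 1)), lt_min hδ (by positivity), fun z hz0 hzd => ?_⟩
  have hzpos : 0 < z := hz0
  rw [Real.dist_eq, sub_zero] at hzd
  have hzδ : z ≤ δ := ((le_abs_self z).trans hzd.le).trans (min_le_left _ _)
  have hzε : z < ε / (C + 1) := lt_of_le_of_lt (le_abs_self z) (lt_of_lt_of_le hzd (min_le_right _ _))
  have h := hexp z hzpos hzδ
  have hz4 : 0 < z ^ 4 := by positivity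
  rw [Real.dist_eq]
  have e : (R z - N) / z ^ 4 - -m = (R z - (N - m * z ^ 4)) / z ^ 4 := by field_simp; ring
  rw [e, abs_div, abs_of_pos hz4, div_lt_iff₀ hz4]
  have h2 : C * z ^ 5 < ε * z ^ 4 := by
    have hCz : C * z < ε := by
      have := (lt_div_iff₀ (by positivity : (0:ℝ) < C + 1)).1 hzε
      nlinarith
    nlinarith [hz4]
  exact lt_of_le_of_lt h h2

/-- `N − C z⁵ ≤ R z ≤ N` (`0 < z ≤ δ`) gives `(R z − N)/z⁴ → 0` as `z → 0⁺` (a point of the arc with a null direction of the quartic form inside the tube). -/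
theorem tendsto_coeff_zero_of_nullDirection {R : ℝ → ℝ} {N C δ : ℝ} (hδ : 0 < δ) (hC : 0 ≤ C)
    (hup : ∀ z : ℝ, 0 < z → z ≤ δ → R z ≤ N) (hlow : ∀ z : ℝ, 0 < z → z ≤ δ → N - C * z ^ 5 ≤ R z) :
    Tendsto (fun z => (R z - N) / z ^ 4) (𝓝[>] 0) (𝓝 0) := by
  have h : Tendsto (fun z => (R z - N) / z ^ 4) (𝓝[>] 0) (𝓝 (-0)) := by
    refine tendsto_coeff_of_expansion (m := 0) (C := C) hδ fun z hz hzδ => ?_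
    rw [zero_mul, sub_zero]
    exact abs_le.2 ⟨by linarith [hlow z hz hzδ], by linarith [hup z hz hzδ, mul_nonneg hC (pow_pos hz 5).le]⟩
  rwa [neg_zero] at h

/-- **NO INTERIOR DEGENERACY.**  If `m` is quasiconcave on `[a₁,a₂]` and positive at both ends, it is positive on the whole interval. -/
theorem no_interior_degeneracy {m : ℝ → ℝ} {a₁ a₂ : ℝ} (hm : QuasiconcaveOn ℝ (Icc a₁ a₂) m) (h₁ : 0 < m a₁) (h₂ : 0 < m a₂)
    {s : ℝ} (hs : s ∈ Icc a₁ a₂) : 0 < m s := by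
  have ha : a₁ ≤ a₂ := hs.1.trans hs.2
  have hc := hm (min (m a₁) (m a₂))
  have hx : a₁ ∈ {x | x ∈ Icc a₁ a₂ ∧ min (m a₁) (m a₂) ≤ m x} := ⟨left_mem_Icc.2 ha, min_le_left _ _⟩
  have hy : a₂ ∈ {x | x ∈ Icc a₁ a₂ ∧ min (m a₁) (m a₂) ≤ m x} := ⟨right_mem_Icc.2 ha, min_le_right _ _⟩
  have hseg := hc.segment_subset hx hy
  have hsmem : s ∈ segment ℝ a₁ a₂ := by rw [segment_eq_Icc ha]; exact hs
  have h := (hseg hsmem).2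
  exact lt_of_lt_of_le (lt_min h₁ h₂) h

/-- Eventually-form of `tendsto_coeff_of_expansion`. -/
theorem tendsto_coeff_of_eventually {R : ℝ → ℝ} {N m C : ℝ}
    (hexp : ∀ᶠ z in 𝓝[>] (0 : ℝ), |R z - (N - m * z ^ 4)| ≤ C * z ^ 5) :
    Tendsto (fun z => (R z - N) / z ^ 4) (𝓝[>] 0) (𝓝 (-m)) := by
  rw [eventually_nhdsWithin_iff, Metric.eventually_nhds_iff] at hexp
  obtain ⟨ε, hε, hball⟩ := hexp
  refine tendsto_coeff_of_expansion (C := C) (δ := ε / 2) (by positivity) fun z hz hzδ => ?_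
  exact hball (by rw [Real.dist_eq, sub_zero, abs_of_pos hz]; linarith) hz

/-- **The limit at a DEFINITE point, with the maximiser confined by «the centre is the only hot point of its cross-section».**  Class-free: `g(n,z)` jointly continuous,
`|g − (N − Q)| ≤ C(|n|+|z|)⁵` on `|n| ≤ r`, `|z| ≤ 1`, `Q` degree-4-homogeneous and definite (`λ(n⁴+z⁴) ≤ Q`), `m = min_η Q(η,1)` attained at `|η₀| ≤ K`, and `g(n,0) < N` for
`0 < |n| ≤ r` (the tube may be THICK: no `64Cr ≤ λ`).  Then `(max_{|n|≤r} g(·,z) − N)/z⁴ → −m` as `z → 0⁺`. -/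
theorem tendsto_coeff_of_definite {g Q : ℝ → ℝ → ℝ} {N lam m η₀ K C r : ℝ}
    (hhom : ∀ η t : ℝ, Q (η * t) t = t ^ 4 * Q η 1)
    (hlam : 0 < lam) (hdef : ∀ n z, lam * (n ^ 4 + z ^ 4) ≤ Q n z)
    (hm : ∀ η, m ≤ Q η 1) (hη₀ : Q η₀ 1 = m) (hK : |η₀| ≤ K) (hC : 0 ≤ C) (hr : 0 < r)
    (hH : ∀ n z : ℝ, |n| ≤ r → |z| ≤ 1 → |g n z - (N - Q n z)| ≤ C * (|n| + |z|) ^ 5)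
    (hcont : Continuous (Function.uncurry g)) (hsole : ∀ n : ℝ, |n| ≤ r → n ≠ 0 → g n 0 < N) :
    Tendsto (fun z => (sSup ((fun n => g n z) '' Icc (-r) r) - N) / z ^ 4) (𝓝[>] 0) (𝓝 (-m)) := by
  have hK0 : 0 ≤ K := (abs_nonneg _).trans hK
  -- a thin radius
  set r' : ℝ := min r (lam / (64 * C + 1)) with hr'
  have hr'0 : 0 < r' := lt_min hr (by positivity)
  have hr'r : r' ≤ r := min_le_left _ _
  have hthin : 64 * C * r' ≤ lam := by
    have h1 : 64 * C * r' ≤ 64 * C * (lam / (64 * C + 1)) := mul_le_mul_of_nonneg_left (min_le_right _ _) (by positivity)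
    have h2 : 64 * C * (lam / (64 * C + 1)) ≤ lam := by
      rw [mul_div_assoc', div_le_iff₀ (by positivity)]; nlinarith
    exact h1.trans h2
  -- cross-sections are continuous; images of compact intervals are compact
  have hsec : ∀ z : ℝ, Continuous fun n => g n z := fun z => hcont.comp (continuous_id.prodMk continuous_const)
  have hcpt : ∀ (z a b : ℝ), IsCompact ((fun n => g n z) '' Icc a b) := fun z a b => isCompact_Icc.image (hsec z)
  set B : ℝ := max 1 (2 * (|m| + 32 * C + C * (K + 1) ^ 5) / lam) with hB
  set C'' : ℝ := C * (K + 1) ^ 5 + C * (B + 1) ^ 5 with hC''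
  -- the thin-tube expansion at radius `r'`
  have hthinexp : ∀ z : ℝ, 0 < z → z ≤ min 1 (r' / (K + 1)) →
      |sSup ((fun n => g n z) '' Icc (-r') r') - (N - m * z ^ 4)| ≤ C'' * z ^ 5 := by
    intro z hz hzle
    have hz1 : |z| ≤ 1 := by rw [abs_of_pos hz]; exact hzle.trans (min_le_left _ _)
    have hKz : K * |z| ≤ r' := by
      rw [abs_of_pos hz]
      have h1 : K * z ≤ K * (r' / (K + 1)) := mul_le_mul_of_nonneg_left (hzle.trans (min_le_right _ _)) hK0
      have h2 : K * (r' / (K + 1)) ≤ r' := by rw [mul_div_assoc', div_le_iff₀ (by linarith)]; nlinarith [hr'0.le]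
      exact h1.trans h2
    have h := abs_sSup_sub_le_of_quarticRidgeExpansion' (g := g) (δ := 1) hhom hlam hdef hm hη₀ hK hC hr'0 hthin
      (fun n z' hn hz' => hH n z' (hn.trans hr'r) hz') (fun z' _ => (hsec z').continuousOn) hz1 hz1 hKz
    rw [abs_of_pos hz] at h
    exact h
  -- the annulus `r' ≤ |n| ≤ r` is cold at height 0, by a margin `d`
  set A : Set ℝ := Icc (-r) (-r') ∪ Icc r' r with hA
  have hAc : IsCompact A := isCompact_Icc.union isCompact_Icc
  have hAne : A.Nonempty := ⟨r, Or.inr ⟨hr'r, le_rfl⟩⟩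
  have hAmem : ∀ n ∈ A, |n| ≤ r ∧ n ≠ 0 ∧ r' ≤ |n| := by
    intro n hn
    rcases hn with ⟨h1, h2⟩ | ⟨h1, h2⟩
    · refine ⟨abs_le.2 ⟨h1, by linarith⟩, by intro h0; rw [h0] at h2; linarith, ?_⟩
      rw [abs_of_neg (by linarith)]; linarith
    · refine ⟨abs_le.2 ⟨by linarith, h2⟩, by intro h0; rw [h0] at h1; linarith, ?_⟩
      rw [abs_of_pos (by linarith)]; exact h1
  obtain ⟨n₀, hn₀A, hn₀max⟩ := hAc.exists_isMaxOn hAne (hsec 0).continuousOn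
  set d : ℝ := N - g n₀ 0 with hd
  have hd0 : 0 < d := by
    have := hsole n₀ (hAmem n₀ hn₀A).1 (hAmem n₀ hn₀A).2.1
    rw [hd]; linarith
  have hcold0 : ∀ n ∈ A, g n 0 ≤ N - d := fun n hn => by
    have := hn₀max hn; rw [hd]; simp only [mem_setOf_eq] at this; linarith
  -- … and stays cold for small `z` (compactness of the annulus, joint continuity)
  have hcold : ∀ᶠ z in 𝓝 (0 : ℝ), ∀ n ∈ A, g n z < N - d / 2 := by
    refine hAc.eventually_forall_of_forall_eventually (P := fun z n => g n z < N - d / 2) fun n hn => ?_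
    have hc : ContinuousAt (fun p : ℝ × ℝ => g p.2 p.1) ((0 : ℝ), n) :=
      (hcont.comp continuous_swap).continuousAt
    have hlt : g n 0 < N - d / 2 := by linarith [hcold0 n hn]
    exact hc.eventually (gt_mem_nhds hlt)
  -- the polynomial margin is eventually below `d/2`
  have hpoly : ∀ᶠ z in 𝓝 (0 : ℝ), |m| * z ^ 4 + C'' * |z| ^ 5 < d / 2 := by
    have hc : Continuous fun z : ℝ => |m| * z ^ 4 + C'' * |z| ^ 5 := by fun_prop
    have h0 : (fun z : ℝ => |m| * z ^ 4 + C'' * |z| ^ 5) 0 < d / 2 := by simp; linarith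
    exact hc.continuousAt.eventually (gt_mem_nhds h0)
  -- assemble the eventual two-sided bound at radius `r`
  refine tendsto_coeff_of_eventually (C := C'') ?_
  have hsmall : ∀ᶠ z in 𝓝[>] (0 : ℝ), z ≤ min 1 (r' / (K + 1)) := by
    have : ∀ᶠ z in 𝓝 (0 : ℝ), z ≤ min 1 (r' / (K + 1)) := by
      have hpos : 0 < min 1 (r' / (K + 1)) := lt_min one_pos (by positivity)
      filter_upwards [Metric.closedBall_mem_nhds (0 : ℝ) hpos] with z hz
      rw [Metric.mem_closedBall, Real.dist_eq, sub_zero] at hz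
      exact (le_abs_self z).trans hz
    exact nhdsWithin_le_nhds this
  have hposz : ∀ᶠ z in 𝓝[>] (0 : ℝ), 0 < z := self_mem_nhdsWithin
  filter_upwards [hposz, hsmall, nhdsWithin_le_nhds hcold, nhdsWithin_le_nhds hpoly] with z hz hzle hcoldz hpolyz
  have hthin_z := hthinexp z hz hzle
  have hC''0 : 0 ≤ C'' := by positivity
  -- images at radius r' and r
  have hbig_bdd : BddAbove ((fun n => g n z) '' Icc (-r) r) := (hcpt z (-r) r).bddAbove
  have hsub : (fun n => g n z) '' Icc (-r') r' ⊆ (fun n => g n z) '' Icc (-r) r :=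
    image_mono (Icc_subset_Icc (by linarith) hr'r)
  have hsmall_ne : ((fun n => g n z) '' Icc (-r') r').Nonempty := ⟨g 0 z, 0, ⟨by linarith, hr'0.le⟩, rfl⟩
  have hmono : sSup ((fun n => g n z) '' Icc (-r') r') ≤ sSup ((fun n => g n z) '' Icc (-r) r) := csSup_le_csSup hbig_bdd hsmall_ne hsub
  obtain ⟨nstar, hnstar, hmax⟩ := (hcpt z (-r) r).sSup_mem ⟨g 0 z, 0, ⟨by linarith, hr.le⟩, rfl⟩
  have hlow := (abs_le.1 hthin_z).1
  have hup_thin := (abs_le.1 hthin_z).2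
  rw [abs_le]
  constructor
  · linarith
  · -- the maximiser over `|n| ≤ r` lies in the thin tube
    by_cases hin : |nstar| ≤ r'
    · have hle : g nstar z ≤ sSup ((fun n => g n z) '' Icc (-r') r') :=
        le_csSup (hcpt z (-r') r').bddAbove ⟨nstar, ⟨(abs_le.1 hin).1, (abs_le.1 hin).2⟩, rfl⟩
      rw [← hmax]; linarith
    · exfalso
      have hA' : nstar ∈ A := by
        push Not at hin
        rcases le_or_gt 0 nstar with h0 | h0
        · right; exact ⟨by rw [abs_of_nonneg h0] at hin; exact hin.le, hnstar.2⟩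
        · left; exact ⟨hnstar.1, by rw [abs_of_neg h0] at hin; linarith⟩
      have h1 := hcoldz nstar hA'
      have hz5 : C'' * z ^ 5 ≤ C'' * |z| ^ 5 := by rw [abs_of_pos hz]
      have hm4 : m * z ^ 4 ≤ |m| * z ^ 4 := mul_le_mul_of_nonneg_right (le_abs_self m) (pow_nonneg hz.le 4)
      have : N - d / 2 < sSup ((fun n => g n z) '' Icc (-r') r') := by linarith
      linarith [hmax.symm.le, hmono]

/-- **The limit at a point with a NULL DIRECTION inside the tube.**  Class-free: `|g − (N − Q)| ≤ C(|n|+|z|)⁵` on `|n| ≤ r`, `|z| ≤ 1`, `Q` degree-4-homogeneous with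
`Q(η₀,1) = 0`, and the global bound `g ≤ N` on the tube.  Then `(sup_{|n|≤r} g(·,z) − N)/z⁴ → 0` as `z → 0⁺` (no continuity needed). -/
theorem tendsto_coeff_of_nullDirection {g Q : ℝ → ℝ → ℝ} {N η₀ C r : ℝ}
    (hhom : ∀ η t : ℝ, Q (η * t) t = t ^ 4 * Q η 1) (hnull : Q η₀ 1 = 0) (hC : 0 ≤ C) (hr : 0 < r)
    (hH : ∀ n z : ℝ, |n| ≤ r → |z| ≤ 1 → |g n z - (N - Q n z)| ≤ C * (|n| + |z|) ^ 5)
    (hglob : ∀ n z : ℝ, |n| ≤ r → g n z ≤ N) :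
    Tendsto (fun z => (sSup ((fun n => g n z) '' Icc (-r) r) - N) / z ^ 4) (𝓝[>] 0) (𝓝 0) := by
  set δ : ℝ := min 1 (r / (|η₀| + 1)) with hδ
  have hδ0 : 0 < δ := lt_min one_pos (by positivity)
  have hbdd : ∀ z, BddAbove ((fun n => g n z) '' Icc (-r) r) := fun z =>
    ⟨N, by rintro _ ⟨n, hn, rfl⟩; exact hglob n z (abs_le.2 ⟨hn.1, hn.2⟩)⟩
  refine tendsto_coeff_zero_of_nullDirection (C := C * (|η₀| + 1) ^ 5) hδ0 (by positivity) (fun z hz _ => ?_) (fun z hz hzδ => ?_)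
  · exact csSup_le ⟨g 0 z, 0, ⟨by linarith, hr.le⟩, rfl⟩ (by rintro _ ⟨n, hn, rfl⟩; exact hglob n z (abs_le.2 ⟨hn.1, hn.2⟩))
  · have hz1 : |z| ≤ 1 := by rw [abs_of_pos hz]; exact hzδ.trans (min_le_left _ _)
    have hn₁ : |η₀ * z| ≤ r := by
      rw [abs_mul, abs_of_pos hz]
      have h1 : |η₀| * z ≤ |η₀| * (r / (|η₀| + 1)) := mul_le_mul_of_nonneg_left (hzδ.trans (min_le_right _ _)) (abs_nonneg _)
      have h2 : |η₀| * (r / (|η₀| + 1)) ≤ r := by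
        rw [mul_div_assoc', div_le_iff₀ (by positivity)]; nlinarith [hr.le, abs_nonneg η₀]
      exact h1.trans h2
    have h := (abs_le.1 (hH (η₀ * z) z hn₁ hz1)).1
    rw [hhom, hnull, mul_zero, sub_zero] at h
    have hle : g (η₀ * z) z ≤ sSup ((fun n => g n z) '' Icc (-r) r) :=
      le_csSup (hbdd z) ⟨η₀ * z, ⟨(abs_le.1 hn₁).1, (abs_le.1 hn₁).2⟩, rfl⟩
    have hrem : C * (|η₀ * z| + |z|) ^ 5 = C * (|η₀| + 1) ^ 5 * z ^ 5 := by
      rw [abs_mul, abs_of_pos hz]; ring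
    linarith

end Summit.NavierStokesRegularity.NavierStokesRegularity.Theorems.PoloidalWindowDoorLrcModEntireTwistingTHFlatLeverPointwise
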